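import Mathlib

/-!
# Sketch (val-idea-23 g2, card `reshaping-generic`): Hutchinson profiles are reshaping-generic —
# the tensor-train / ordered-ABP sector of the cancellation (RVP) door, typed.

Defs/Props only (no proofs claimed here). Crux of record: `…Theses.LacunarySymmetroid.MatrixDescartes`
(stmt-ValiantsHypothesis-18050); door of record: `…Theorems.MatrixDescartes.Negative.MatrixDescartesFalseOfRVPMonster`.
Nothing here bears on VP ≠ VNP.
-/

namespace Summit.ValiantsHypothesis.ValiantsHypothesis.Cruxes.MatrixDescartes.ReshapingGeneric

open scoped BigOperators
open Polynomial

/-- A positive sequence whose consecutive ratios drop by the factor `q` at every step: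
`q · f k · f (k+2) ≤ f (k+1)²` (Hutchinson's hypothesis is `q = 4`). -/
def IsStrongLogConcave (q : ℝ) (f : ℕ → ℝ) : Prop :=
  (∀ k, 0 < f k) ∧ ∀ k, q * (f k * f (k + 2)) ≤ f (k + 1) ^ 2

/-- The base-`P` digit reshaping of a sequence: the `P × H` matrix `(x, y) ↦ f (P·y + x)`
(low digit = row, high digit = column); for `f` = the coefficient profile of a digit lift this is the
flattening of the coefficient tensor at the cut «digit 0 | digits ≥ 1», and iterating in base `B^t` gives every
sequential (tensor-train) cut. -/
def reshape (f : ℕ → ℝ) (P H : ℕ) : Matrix (Fin P) (Fin H) ℝ :=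
  Matrix.of fun x y => f (P * (y : ℕ) + (x : ℕ))

/-- FIRST LEMMA (robust Vandermonde; the card's K1, claimed provable now): a strongly log-concave sequence is
reshaping-generic — every digit reshaping has full rank.  (Proof sketch on the card: the log-matrix is strictly
Monge with gap `P·log q` between blocks, so every square minor has a unique optimal assignment with margin
`≥ P log q` per inversion and the dominant term of the Leibniz expansion wins: tropically non-singular with
margin ⇒ non-singular.) -/
def ReshapingGeneric : Prop :=
  ∀ q : ℝ, 4 ≤ q → ∀ f : ℕ → ℝ, IsStrongLogConcave q f →
    ∀ P H : ℕ, (reshape f P H).rank = min P H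

/-- The generalized-Hankel form for an ARBITRARY digit cut: rows indexed by numbers `a` supported on a digit set
`S`, columns by numbers `b` supported on its complement, entry `f (a + b)` (no carries).  Stated for arbitrary
finite index sets of naturals with pairwise sums; the card's K1′ asks full rank up to a `polylog` loss after
passing to `s`-spread sub-families. -/
def hankelCut (f : ℕ → ℝ) {ι κ : Type*} (a : ι → ℕ) (b : κ → ℕ) : Matrix ι κ ℝ :=
  Matrix.of fun i j => f (a i + b j)

/-- Spread version of genericity (K1′): if the row labels and the column labels are each `s`-separated
(`a i + s ≤ a i'` for `i < i'`, likewise `b`) with `q ^ (s*s) ≥ 4 * (number of rows)`, the Hankel cut of a strongly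
log-concave sequence has full row rank. -/
def SpreadHankelGeneric : Prop :=
  ∀ q : ℝ, 1 < q → ∀ f : ℕ → ℝ, IsStrongLogConcave q f →
    ∀ (r c s : ℕ) (a : Fin r → ℕ) (b : Fin c → ℕ), r ≤ c → StrictMono a → StrictMono b →
      (∀ i j : Fin r, i < j → a i + s ≤ a j) → (∀ i j : Fin c, i < j → b i + s ≤ b j) →
      (4 * r : ℝ) ≤ q ^ (s * s) → (hankelCut f a b).rank = r

/-- The digit lift of a profile `f` in base `B` with `n` digit variables:
`L_f = Σ_{e ∈ [B]^n} f(Σ_i e_i B^i) · Π_i y_i^{e_i}` — the object every cancellation-road monster of record is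
(theta: `f k = (−1)^k 2^{−2k²}`, route file docstring; Chebyshev / Pochhammer variants in the seat memo). -/
noncomputable def digitLift (B n : ℕ) (f : ℕ → ℝ) : MvPolynomial (Fin n) ℝ :=
  ∑ e : Fin n → Fin B, MvPolynomial.C (f (∑ i, (e i : ℕ) * B ^ (i : ℕ))) * ∏ i, MvPolynomial.X i ^ (e i : ℕ)

/-- Kronecker substitution lands the digit lift on the one-variable lacunary polynomial `Σ_{k<B^n} f k · X^{c k}`
(the RVP door's shape `aeval (fun i => X ^ d i)` with `d i = c · B^i`).  Support statement (routine). -/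
def KroneckerDigit : Prop :=
  ∀ (B n c : ℕ) (f : ℕ → ℝ), 2 ≤ B →
    MvPolynomial.aeval (fun i : Fin n => (X : ℝ[X]) ^ (c * B ^ (i : ℕ))) (digitLift B n f)
      = ∑ k ∈ Finset.range (B ^ n), Polynomial.C (f k) * X ^ (c * k)

/-- THE SECTOR LAW the card files (K2, informal part in the docstring): an ordered ABP (read-once oblivious, any
variable order, individual degree `< B`) of width `w` computing `digitLift B n f` for a strongly log-concave
alternating `f` has `w ≥ B^{⌊n/2⌋}`; hence its standard determinantal pencil has size `m ≥ B^{⌊n/2⌋}` and at most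
`B^n − 1 ≤ m² ` positive zeros on the Kronecker curve — polynomial in the size, never an `RVPMonster`.  Typed
here only through its linear-algebra core `ReshapingGeneric` (Nisan's width = flattening-rank characterisation is
the cited bridge, not re-typed). -/
def TTSectorLaw : Prop := ReshapingGeneric ∧ SpreadHankelGeneric

end Summit.ValiantsHypothesis.ValiantsHypothesis.Cruxes.MatrixDescartes.ReshapingGeneric
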